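import Literature.NumberTheory.LFunctions.MertensNumberFieldResidue
import HarnessLib

/-!
# Mertens' theorem for the prime ideals of a number field with the RESIDUE constant, II:
# `∑_{N𝔭 ≤ x} −log(1 − 1/N𝔭) = log log x + γ + log κ_K + O_K(1/log² x)` (Rosen 1999, Theorem 2)

Topic `Literature/NumberTheory/LFunctions` (sequel of `MertensNumberFieldResidue.lean`).  Everything in this file is
PROVED (theorems only); it is a reproduction with citation of M. Rosen, *A generalization of Mertens' theorem*,
J. Ramanujan Math. Soc. 14 (1999), Theorem 2, for EVERY number field `K` (the tree had `K = ℚ(∛2)` only,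
`HeathBrownCubicMertensK.lean`), by Hardy–Wright's Abelian argument (§22.8) organised by the norm:

* `sum_Icc_normWeight_eq`, `normSum_bounds`, `hasSum_normWeight_rpow` — the Dirichlet series
  `D(σ) = ∑_m (G(m)/m) m^{-σ} = σ ∫_1^∞ T(x) x^{-σ-1} dx` with `T(x) = ∑_{m ≤ x} G(m)/m = ∑_{N𝔭 ≤ x} 1/N𝔭`,
  `0 ≤ T(x) ≤ [K:ℚ](1 + log x)` (Mathlib `LSeries_eq_mul_integral'`);
* `tendsto_normSum_sub_loglog`, `tendsto_D_add_log` — `T(x) − log log x → M_K` and hence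
  `D(σ) + log σ → M_K − γ` (`σ → 0⁺`; Abelian lemma `Mertens.tendsto_mul_integral_rpow_of_tendsto`,
  `σ ∫ log log x · x^{-σ-1} dx = −γ − log σ` of `NicolasMellin`);
* `tendsto_log_dedekindZeta_add_log` — `log ζ_K(1+σ) + log σ → log κ_K` (Mathlib's class number formula limit);
* `log_dedekindZeta_eq` — `log ζ_K(1+σ) = D(σ) + ∑_m r_m(1+σ)`;
* `mertensConstant_eq_log_residue` — **`M_K − γ + ∑_m r_m(1) = log κ_K`** for THE Mertens constant `M_K` of `K`
  (any witness of `exists_mertensConstant`);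
* `abs_sum_neg_log_sub_le` — **`|∑_{N𝔭 ≤ x} −log(1 − 1/N𝔭) − (log log x + γ + log κ_K)| ≤ C_K/log² x`** for all
  `x ≥ 2`, i.e. `∏_{N𝔭 ≤ x}(1 − 1/N𝔭)^{-1} = e^{γ} κ_K log x · e^{O_K(1/log² x)}` (Rosen's Theorem 2).

## References

* M. Rosen, *A generalization of Mertens' theorem*, J. Ramanujan Math. Soc. 14 (1999) 1–19, Theorem 2.
  [Rosen1999Mertens]
* G. H. Hardy, E. M. Wright, *An Introduction to the Theory of Numbers*, §22.8, Theorem 428 (the method).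
  [HardyWright2008]
* H. L. Montgomery, R. C. Vaughan, *Multiplicative Number Theory I*, §1.2, Thm 1.3 (partial summation for
  Dirichlet series). [MontgomeryVaughan2007]
-/

noncomputable section

open Finset Real MeasureTheory Filter Set Topology NumberField IsDedekindDomain
open scoped NumberField

namespace Literature.NumberTheory.LFunctions.NumberField

open Literature.NumberTheory.Sieve.CubicSieve (hasProd_realEulerFactor)

variable (K : Type*) [Field K] [NumberField K]

/-! ### The summatory function `T(x) = ∑_{m ≤ x} G(m)/m` -/

/-- `∑_{m ∈ Icc 1 N} G(m)/m = ∑_{m ∈ Icc 0 N} G(m)/m` (the term `m = 0` vanishes). [cite: HardyWright2008, §22.8 (proof of Theorem 428)] -/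
theorem sum_Icc_one_normWeight_eq (N : ℕ) :
    ∑ m ∈ Icc 1 N, (normPrimeIdealCount K m : ℝ) / m = ∑ m ∈ Icc 0 N, (normPrimeIdealCount K m : ℝ) / m := by
  have h : Finset.Icc 0 N = insert 0 (Finset.Icc 1 N) := by
    ext m; simp only [Finset.mem_insert, Finset.mem_Icc]; omega
  rw [h, Finset.sum_insert (by simp)]
  simp

/-- `∑_{N𝔭 ≤ x} 1/N𝔭 = ∑_{m ≤ x} G(m)/m` for `x ≥ 0`. [cite: LandauMathAnn1903, p. 669 (G(n))] -/
theorem sum_inv_absNorm_eq_normSum {x : ℝ} (hx : 0 ≤ x) :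
    ∑ P ∈ (finite_primeIdealsLE K x).toFinset, (Ideal.absNorm P : ℝ)⁻¹ =
      ∑ m ∈ Icc 0 ⌊x⌋₊, (normPrimeIdealCount K m : ℝ) / m := by
  rw [sum_primeIdealsLE_eq_sum_normPrimeIdealCount (f := fun n => (n : ℝ)⁻¹) hx]
  exact Finset.sum_congr rfl fun m _ ↦ by rw [div_eq_mul_inv]

/-- **`0 ≤ T(x) ≤ [K:ℚ](1 + log x)`** for `x ≥ 1` (`G(m) ≤ [K:ℚ]` and the harmonic sum). [cite: HardyWright2008, §22.8 (proof of Theorem 428)] -/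
theorem normSum_bounds {x : ℝ} (hx : 1 ≤ x) :
    0 ≤ ∑ m ∈ Icc 0 ⌊x⌋₊, (normPrimeIdealCount K m : ℝ) / m ∧
      ∑ m ∈ Icc 0 ⌊x⌋₊, (normPrimeIdealCount K m : ℝ) / m ≤ (Module.finrank ℚ K : ℝ) * (1 + Real.log x) := by
  have h0 : 0 ≤ ∑ m ∈ Icc 0 ⌊x⌋₊, (normPrimeIdealCount K m : ℝ) / m := sum_nonneg fun m _ => by positivity
  refine ⟨h0, ?_⟩
  have hn : 1 ≤ ⌊x⌋₊ := Nat.le_floor (by simpa using hx)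
  set d : ℝ := (Module.finrank ℚ K : ℝ) with hd
  have hd0 : 0 ≤ d := Nat.cast_nonneg _
  rw [← sum_Icc_one_normWeight_eq]
  calc ∑ m ∈ Icc 1 ⌊x⌋₊, (normPrimeIdealCount K m : ℝ) / m
      ≤ ∑ m ∈ Icc 1 ⌊x⌋₊, d / (m : ℝ) := sum_le_sum fun m hm => by
          have hm1 : (1 : ℝ) ≤ m := by exact_mod_cast (Finset.mem_Icc.mp hm).1
          have hG : (normPrimeIdealCount K m : ℝ) ≤ d := by
            rw [hd]; exact_mod_cast normPrimeIdealCount_le_finrank K m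
          exact div_le_div_of_nonneg_right hG (by linarith)
    _ = d * ∑ m ∈ Icc 1 ⌊x⌋₊, (m : ℝ)⁻¹ := by rw [mul_sum]; exact sum_congr rfl fun m _ => by rw [div_eq_mul_inv]
    _ ≤ d * (1 + Real.log ⌊x⌋₊) := by
        refine mul_le_mul_of_nonneg_left ?_ hd0
        have h := harmonic_le_one_add_log ⌊x⌋₊
        have hh : (harmonic ⌊x⌋₊ : ℝ) = ∑ k ∈ Icc 1 ⌊x⌋₊, (k : ℝ)⁻¹ := by
          rw [harmonic_eq_sum_Icc]; push_cast; rfl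
        rw [← hh]; exact h
    _ ≤ d * (1 + Real.log x) := by
        have : Real.log (⌊x⌋₊ : ℝ) ≤ Real.log x :=
          Real.log_le_log (by exact_mod_cast hn) (Nat.floor_le (by linarith))
        nlinarith

/-- `T` is measurable (a step function of `⌊x⌋`). [cite: HardyWright2008, §22.8 (proof of Theorem 428)] -/
theorem measurable_normSum :
    Measurable fun x : ℝ => ∑ m ∈ Icc 0 ⌊x⌋₊, (normPrimeIdealCount K m : ℝ) / m :=
  ThetaMertens.measurable_comp_natFloor fun N => ∑ m ∈ Icc 0 N, (normPrimeIdealCount K m : ℝ) / m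

/-- `T(x) x^{-σ-1}` is integrable on `(1, ∞)` for `σ > 0`. [cite: HardyWright2008, §22.8 (proof of Theorem 428)] -/
theorem integrableOn_normSum_rpow {σ : ℝ} (hσ : 0 < σ) :
    IntegrableOn (fun x => (∑ m ∈ Icc 0 ⌊x⌋₊, (normPrimeIdealCount K m : ℝ) / m) * x ^ (-(σ + 1))) (Set.Ioi 1) :=
  Literature.NumberTheory.LFunctions.Nicolas.integrableOn_rpow_of_le_log (measurable_normSum K)
    (C := Module.finrank ℚ K) (fun x hx => by
      obtain ⟨h0, h1⟩ := normSum_bounds K hx.le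
      rw [abs_of_nonneg h0]; exact h1) hσ

/-! ### `D(σ) = ∑_m (G(m)/m) m^{-σ} = σ ∫_1^∞ T(x) x^{-σ-1} dx` -/

/-- **`D(σ) = ∑_m (G(m)/m) m^{-σ} = σ ∫_1^∞ T(x) x^{-σ-1} dx`** for `σ > 0`, and the series converges (Mathlib's
partial summation `LSeries_eq_mul_integral'`, made real). [cite: MontgomeryVaughan2007, §1.2, Thm. 1.3] -/
theorem hasSum_normWeight_rpow {σ : ℝ} (hσ : 0 < σ) :
    HasSum (fun m : ℕ => (normPrimeIdealCount K m : ℝ) / m * (m : ℝ) ^ (-σ))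
      (σ * ∫ x in Set.Ioi (1 : ℝ), (∑ m ∈ Icc 0 ⌊x⌋₊, (normPrimeIdealCount K m : ℝ) / m) * x ^ (-(σ + 1))) := by
  set w : ℕ → ℝ := fun m => (normPrimeIdealCount K m : ℝ) / m with hw
  have hw0 : ∀ m, 0 ≤ w m := fun m => by rw [hw]; positivity
  set f : ℕ → ℂ := fun m => (w m : ℂ) with hf
  set d : ℝ := (Module.finrank ℚ K : ℝ) with hd
  -- growth of partial sums: `T(n) ≤ d(1 + log n) ≤ C n^{σ/2}`
  have hr : (0 : ℝ) ≤ σ / 2 := by linarith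
  have hO : (fun n : ℕ => ∑ k ∈ Icc 1 n, ‖f k‖) =O[atTop] fun n : ℕ => (n : ℝ) ^ (σ / 2) := by
    refine Asymptotics.IsBigO.of_bound (d * (1 + 2 / σ)) ?_
    filter_upwards [eventually_ge_atTop 1] with n hn
    have hn1 : (1 : ℝ) ≤ n := by exact_mod_cast hn
    have hnorm : ∀ k, ‖f k‖ = w k := fun k => by
      rw [hf]; simp only [Complex.norm_real, Real.norm_eq_abs, abs_of_nonneg (hw0 k)]
    simp only [hnorm]
    have hbounds := normSum_bounds K hn1
    rw [Nat.floor_natCast] at hbounds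
    rw [hw, sum_Icc_one_normWeight_eq, Real.norm_of_nonneg hbounds.1, Real.norm_of_nonneg (by positivity)]
    have hlog : Real.log n ≤ (n : ℝ) ^ (σ / 2) / (σ / 2) := Real.log_le_rpow_div (by linarith) (by linarith)
    have hpow1 : (1 : ℝ) ≤ (n : ℝ) ^ (σ / 2) := Real.one_le_rpow hn1 hr
    have hd0 : 0 ≤ d := Nat.cast_nonneg _
    calc ∑ m ∈ Icc 0 n, (normPrimeIdealCount K m : ℝ) / m ≤ d * (1 + Real.log n) := hbounds.2
      _ ≤ d * ((n : ℝ) ^ (σ / 2) + (n : ℝ) ^ (σ / 2) / (σ / 2)) := by gcongr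
      _ = d * (1 + 2 / σ) * (n : ℝ) ^ (σ / 2) := by field_simp
  have hC := LSeries_eq_mul_integral' f hr (s := (σ : ℂ)) (by simpa using (by linarith : σ / 2 < σ)) hO
  have hSumm : LSeriesSummable f σ :=
    LSeriesSummable_of_sum_norm_bigO hO hr (by simpa using (by linarith : σ / 2 < σ))
  -- real forms of both sides
  have hterm : ∀ k : ℕ, LSeries.term f σ k = ((w k * (k : ℝ) ^ (-σ) : ℝ) : ℂ) := by
    intro k
    rcases Nat.eq_zero_or_pos k with rfl | hk
    · simp [LSeries.term, hw]
    · rw [LSeries.term_of_ne_zero hk.ne', hf]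
      have hk0 : (0 : ℝ) ≤ k := Nat.cast_nonneg k
      rw [show ((k : ℕ) : ℂ) = (((k : ℕ) : ℝ) : ℂ) by norm_cast, ← Complex.ofReal_cpow hk0, Real.rpow_neg hk0]
      push_cast
      rw [div_eq_mul_inv]
  have hLHS : LSeries f σ = ((∑' k : ℕ, w k * (k : ℝ) ^ (-σ) : ℝ) : ℂ) := by
    rw [LSeries, Complex.ofReal_tsum]; exact tsum_congr hterm
  have hsumR : Summable fun k : ℕ => w k * (k : ℝ) ^ (-σ) := by
    have : Summable fun k : ℕ => ((w k * (k : ℝ) ^ (-σ) : ℝ) : ℂ) := by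
      have h := hSumm
      rw [LSeriesSummable] at h
      exact h.congr hterm
    exact (Complex.summable_ofReal).mp this
  have hRHS : (σ : ℂ) * ∫ t in Set.Ioi (1 : ℝ), (∑ k ∈ Icc 1 ⌊t⌋₊, f k) * (t : ℂ) ^ (-((σ : ℂ) + 1)) =
      ((σ * ∫ x in Set.Ioi (1 : ℝ), (∑ m ∈ Icc 0 ⌊x⌋₊, w m) * x ^ (-(σ + 1)) : ℝ) : ℂ) := by
    have hint : ∫ t in Set.Ioi (1 : ℝ), (∑ k ∈ Icc 1 ⌊t⌋₊, f k) * (t : ℂ) ^ (-((σ : ℂ) + 1)) =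
        ∫ t in Set.Ioi (1 : ℝ), (((∑ m ∈ Icc 0 ⌊t⌋₊, w m) * t ^ (-(σ + 1)) : ℝ) : ℂ) := by
      refine MeasureTheory.setIntegral_congr_fun measurableSet_Ioi fun t ht => ?_
      have ht0 : (0 : ℝ) ≤ t := by linarith [ht.out]
      rw [hf, ← Complex.ofReal_sum, hw, sum_Icc_one_normWeight_eq,
        show (-((σ : ℂ) + 1)) = ((-(σ + 1) : ℝ) : ℂ) by push_cast; ring, ← Complex.ofReal_cpow ht0]
      push_cast; ring
    rw [hint, integral_complex_ofReal]; push_cast; ring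
  rw [hLHS, hRHS, Complex.ofReal_inj] at hC
  rw [← hC]
  exact hsumR.hasSum

/-! ### The limits as `σ → 0⁺` -/

variable {K} in
/-- `T(x) − log log x → M_K` for any Mertens constant witness `M` (`|T(x) − (log log x + M)| ≤ C/log² x`, `x ≥ 2`).
[cite: Rosen1999Mertens, Lemma 2.3] -/
theorem tendsto_normSum_sub_loglog {M C : ℝ}
    (hM : ∀ x : ℝ, 2 ≤ x →
      |∑ P ∈ (finite_primeIdealsLE K x).toFinset, (Ideal.absNorm P : ℝ)⁻¹ - (Real.log (Real.log x) + M)| ≤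
        C / Real.log x ^ 2) :
    Tendsto (fun x : ℝ => (∑ m ∈ Icc 0 ⌊x⌋₊, (normPrimeIdealCount K m : ℝ) / m) - Real.log (Real.log x))
      atTop (𝓝 M) := by
  have h := tendsto_sum_inv_absNorm_sub_loglog K hM
  have h2 : Tendsto (fun x : ℝ => (∑ P ∈ (finite_primeIdealsLE K x).toFinset, (Ideal.absNorm P : ℝ)⁻¹ -
      (Real.log (Real.log x) + M)) + M) atTop (𝓝 (0 + M)) := h.add_const M
  rw [zero_add] at h2
  refine h2.congr' ?_
  filter_upwards [eventually_ge_atTop (0 : ℝ)] with x hx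
  rw [sum_inv_absNorm_eq_normSum K hx]; ring

variable {K} in
/-- **`D(σ) + log σ → M_K − γ` as `σ → 0⁺`** (split off `σ ∫ log log x · x^{-σ-1} dx = −γ − log σ` and apply the
Abelian lemma to `T − log log → M_K`). [cite: HardyWright2008, §22.8 (proof of Theorem 428)] -/
theorem tendsto_D_add_log {M C : ℝ}
    (hM : ∀ x : ℝ, 2 ≤ x →
      |∑ P ∈ (finite_primeIdealsLE K x).toFinset, (Ideal.absNorm P : ℝ)⁻¹ - (Real.log (Real.log x) + M)| ≤
        C / Real.log x ^ 2) :
    Tendsto (fun σ : ℝ => σ * (∫ x in Set.Ioi (1 : ℝ),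
      (∑ m ∈ Icc 0 ⌊x⌋₊, (normPrimeIdealCount K m : ℝ) / m) * x ^ (-(σ + 1))) + Real.log σ) (𝓝[>] 0)
      (𝓝 (M - Real.eulerMascheroniConstant)) := by
  set T : ℝ → ℝ := fun x => ∑ m ∈ Icc 0 ⌊x⌋₊, (normPrimeIdealCount K m : ℝ) / m with hT
  have hint : ∀ σ : ℝ, 0 < σ → IntegrableOn
      (fun x => (T x - Real.log (Real.log x)) * x ^ (-(σ + 1))) (Set.Ioi 1) := fun σ hσ =>
    Literature.NumberTheory.LFunctions.Nicolas.integrableOn_sub_rpow (integrableOn_normSum_rpow K hσ)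
      (Literature.NumberTheory.LFunctions.Nicolas.integrableOn_loglog_rpow hσ)
  have hA := Literature.NumberTheory.LFunctions.Mertens.tendsto_mul_integral_rpow_of_tendsto hint
    (tendsto_normSum_sub_loglog hM)
  have hev : (fun σ : ℝ => σ * (∫ x in Set.Ioi (1 : ℝ), (T x - Real.log (Real.log x)) * x ^ (-(σ + 1))) -
      Real.eulerMascheroniConstant) =ᶠ[𝓝[>] 0]
      fun σ : ℝ => σ * (∫ x in Set.Ioi (1 : ℝ), T x * x ^ (-(σ + 1))) + Real.log σ := by
    filter_upwards [self_mem_nhdsWithin] with σ (hσ : 0 < σ)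
    have h1 := integrableOn_normSum_rpow K hσ
    have h2 := Literature.NumberTheory.LFunctions.Nicolas.integrableOn_loglog_rpow hσ
    have hsplit : ∫ x in Set.Ioi (1 : ℝ), (T x - Real.log (Real.log x)) * x ^ (-(σ + 1)) =
        (∫ x in Set.Ioi (1 : ℝ), T x * x ^ (-(σ + 1))) -
          ∫ x in Set.Ioi (1 : ℝ), Real.log (Real.log x) * x ^ (-(σ + 1)) := by
      rw [← MeasureTheory.integral_sub h1 h2]
      exact MeasureTheory.setIntegral_congr_fun measurableSet_Ioi fun x _ => by ring
    rw [hsplit, Literature.NumberTheory.LFunctions.Nicolas.integral_loglog_rpow hσ]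
    field_simp
    ring
  exact (hA.sub_const Real.eulerMascheroniConstant).congr' hev

/-- **`log ζ_K(1+σ) + log σ → log κ_K`** (`κ_K` = `dedekindZeta_residue K`; Mathlib's class number formula limit
`NumberField.tendsto_sub_one_mul_dedekindZeta_nhdsGT`). [cite: Rosen1999Mertens, §2 (proof of Theorem 2)] -/
theorem tendsto_log_dedekindZeta_add_log :
    Tendsto (fun σ : ℝ => Real.log (NumberField.dedekindZeta K (1 + σ)).re + Real.log σ) (𝓝[>] 0)
      (𝓝 (Real.log (dedekindZeta_residue K))) := by
  have hρ : 0 < dedekindZeta_residue K := dedekindZeta_residue_pos K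
  have h1 : Tendsto (fun σ : ℝ => 1 + σ) (𝓝[>] (0 : ℝ)) (𝓝[>] 1) := by
    refine tendsto_nhdsWithin_iff.mpr ⟨?_, ?_⟩
    · have : Tendsto (fun σ : ℝ => 1 + σ) (𝓝 0) (𝓝 (1 + 0)) := (continuous_const.add continuous_id).tendsto 0
      rw [add_zero] at this
      exact tendsto_nhdsWithin_of_tendsto_nhds this
    · filter_upwards [self_mem_nhdsWithin] with σ (hσ : 0 < σ)
      exact Set.mem_Ioi.mpr (by linarith)
  have h2 := (NumberField.tendsto_sub_one_mul_dedekindZeta_nhdsGT K).comp h1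
  have h3 : Tendsto (fun σ : ℝ => σ * (NumberField.dedekindZeta K (1 + σ)).re) (𝓝[>] 0)
      (𝓝 (dedekindZeta_residue K)) := by
    have h := (Complex.continuous_re.tendsto _).comp h2
    refine h.congr fun σ => ?_
    simp only [Function.comp_apply]
    rw [show ((1 + σ : ℝ) : ℂ) - 1 = ((σ : ℝ) : ℂ) by push_cast; ring, Complex.re_ofReal_mul]
    norm_num
  have h4 := ((Real.continuousAt_log hρ.ne').tendsto).comp h3
  refine h4.congr' ?_
  filter_upwards [self_mem_nhdsWithin] with σ (hσ : 0 < σ)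
  have hZ := (hasProd_realEulerFactor (L := K) (s := 1 + σ) (by linarith)).2.2
  simp only [Function.comp_apply]
  rw [show ((1 + σ : ℝ) : ℂ) = 1 + (σ : ℂ) by push_cast; ring] at hZ
  rw [Real.log_mul hσ.ne' (by linarith), add_comm]

/-- For `σ > 0`: `w_m(1+σ) = (G(m)/m) m^{-σ} + r_m(1+σ)` for every `m`. [cite: HardyWright2008, §22.8 (proof of Theorem 428)] -/
theorem wTerm_eq_add (m : ℕ) (σ : ℝ) :
    wTerm K m (1 + σ) = (normPrimeIdealCount K m : ℝ) / m * (m : ℝ) ^ (-σ) + rTerm K m (1 + σ) := by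
  rw [rTerm]
  rcases Nat.eq_zero_or_pos m with rfl | hm
  · simp
  · have hm0 : (0 : ℝ) < m := by exact_mod_cast hm
    rw [show (-(1 + σ) : ℝ) = -1 + -σ by ring, Real.rpow_add hm0, Real.rpow_neg_one]
    field_simp
    ring

/-- **`log ζ_K(1+σ) = D(σ) + ∑_m r_m(1+σ)`** for `σ > 0`. [cite: HardyWright2008, §22.8 (proof of Theorem 428)] -/
theorem log_dedekindZeta_eq {σ : ℝ} (hσ : 0 < σ) :
    Real.log (NumberField.dedekindZeta K (1 + σ)).re =
      σ * (∫ x in Set.Ioi (1 : ℝ), (∑ m ∈ Icc 0 ⌊x⌋₊, (normPrimeIdealCount K m : ℝ) / m) * x ^ (-(σ + 1))) +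
        ∑' m : ℕ, rTerm K m (1 + σ) := by
  have hb := hasSum_wTerm K (s := 1 + σ) (by linarith)
  rw [show ((1 + σ : ℝ) : ℂ) = 1 + (σ : ℂ) by push_cast; ring] at hb
  simp_rw [wTerm_eq_add] at hb
  have hD := hasSum_normWeight_rpow K hσ
  have hr : HasSum (fun m : ℕ => rTerm K m (1 + σ)) (Real.log (NumberField.dedekindZeta K (1 + σ)).re -
      σ * ∫ x in Set.Ioi (1 : ℝ), (∑ m ∈ Icc 0 ⌊x⌋₊, (normPrimeIdealCount K m : ℝ) / m) * x ^ (-(σ + 1))) := by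
    have := hb.sub hD
    simpa using this
  rw [hr.tsum_eq]; ring

variable {K} in
/-- **The identification of Mertens' constant: `M_K − γ + ∑_m r_m(1) = log κ_K`**, for any `M` with
`|∑_{N𝔭 ≤ x} 1/N𝔭 − (log log x + M)| ≤ C/log² x` (`x ≥ 2`) — by uniqueness of limits as `σ → 0⁺`.
[cite: Rosen1999Mertens, Theorem 2] -/
theorem mertensConstant_eq_log_residue {M C : ℝ}
    (hM : ∀ x : ℝ, 2 ≤ x →
      |∑ P ∈ (finite_primeIdealsLE K x).toFinset, (Ideal.absNorm P : ℝ)⁻¹ - (Real.log (Real.log x) + M)| ≤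
        C / Real.log x ^ 2) :
    M - Real.eulerMascheroniConstant + ∑' m : ℕ, rTerm K m 1 = Real.log (dedekindZeta_residue K) := by
  have hA := (tendsto_D_add_log hM).add (tendsto_tsum_rTerm K)
  have hB := tendsto_log_dedekindZeta_add_log K
  have hev : (fun σ : ℝ => σ * (∫ x in Set.Ioi (1 : ℝ),
      (∑ m ∈ Icc 0 ⌊x⌋₊, (normPrimeIdealCount K m : ℝ) / m) * x ^ (-(σ + 1))) + Real.log σ +
        ∑' m : ℕ, rTerm K m (1 + σ))
      =ᶠ[𝓝[>] 0] fun σ : ℝ => Real.log (NumberField.dedekindZeta K (1 + σ)).re + Real.log σ := by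
    filter_upwards [self_mem_nhdsWithin] with σ (hσ : 0 < σ)
    rw [log_dedekindZeta_eq K hσ]; ring
  exact tendsto_nhds_unique (hA.congr' hev) hB

/-! ### Mertens' third theorem for `K` with the constant `e^{γ} κ_K` (Rosen's Theorem 2) -/

/-- `∑_{N𝔭 ≤ x} −log(1 − 1/N𝔭) = ∑_{m ≤ x} w_m(1)`. [cite: Rosen1999Mertens, Theorem 2] -/
theorem sum_neg_log_eq_sum_wTerm {x : ℝ} (hx : 0 ≤ x) :
    ∑ P ∈ (finite_primeIdealsLE K x).toFinset, -Real.log (1 - (Ideal.absNorm P : ℝ)⁻¹) =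
      ∑ m ∈ Icc 0 ⌊x⌋₊, wTerm K m 1 := by
  rw [sum_primeIdealsLE_eq_sum_normPrimeIdealCount (f := fun n => -Real.log (1 - (n : ℝ)⁻¹)) hx]
  refine Finset.sum_congr rfl fun m _ ↦ ?_
  rw [wTerm, Real.rpow_neg_one]

/-- `∑_{m ≤ N} w_m(1) = T(N) + ∑_{m ≤ N} r_m(1)`. [cite: HardyWright2008, §22.8 (proof of Theorem 428)] -/
theorem sum_wTerm_one_eq (N : ℕ) :
    ∑ m ∈ Icc 0 N, wTerm K m 1 =
      ∑ m ∈ Icc 0 N, (normPrimeIdealCount K m : ℝ) / m + ∑ m ∈ Icc 0 N, rTerm K m 1 := by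
  rw [← Finset.sum_add_distrib]
  refine Finset.sum_congr rfl fun m _ ↦ ?_
  have h := wTerm_eq_add K m 0
  simp only [add_zero, neg_zero, Real.rpow_zero, mul_one] at h
  exact h

/-- `range (N+1) = Icc 0 N`. [cite: HardyWright2008, §22.8 (proof of Theorem 428)] -/
theorem range_succ_eq_Icc_zero (N : ℕ) : Finset.range (N + 1) = Finset.Icc 0 N := by
  ext m; simp only [Finset.mem_range, Finset.mem_Icc]; omega

/-- **Rosen's Theorem 2 (Mertens' third theorem for a number field, logarithmic form, with the constant
`γ + log κ_K`)**: for every number field `K` there is `C_K` with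
`|∑_{N𝔭 ≤ x} −log(1 − 1/N𝔭) − (log log x + γ + log κ_K)| ≤ C_K/(log x)²` for all `x ≥ 2`; equivalently
`∏_{N𝔭 ≤ x} (1 − 1/N𝔭)^{-1} = e^{γ} κ_K log x · e^{O_K(1/log² x)}`. [cite: Rosen1999Mertens, Theorem 2] -/
theorem abs_sum_neg_log_sub_le :
    ∃ C : ℝ, ∀ x : ℝ, 2 ≤ x →
      |∑ P ∈ (finite_primeIdealsLE K x).toFinset, -Real.log (1 - (Ideal.absNorm P : ℝ)⁻¹) -
          (Real.log (Real.log x) + Real.eulerMascheroniConstant + Real.log (dedekindZeta_residue K))| ≤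
        C / Real.log x ^ 2 := by
  obtain ⟨M, C, hM⟩ := exists_mertensConstant K
  have hid := mertensConstant_eq_log_residue hM
  set d : ℝ := (Module.finrank ℚ K : ℝ) with hd
  have hd0 : 0 ≤ d := Nat.cast_nonneg _
  refine ⟨C + 16 * d, fun x hx ↦ ?_⟩
  have hx0 : 0 < x := by linarith
  have hlx : 0 < Real.log x := Real.log_pos (by linarith)
  set N : ℕ := ⌊x⌋₊ with hN
  have hN2 : 2 ≤ N := Nat.le_floor (by simpa using hx)
  have hN1 : 1 ≤ N := by omega
  have hNx : x / 2 ≤ (N : ℝ) := by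
    have := Nat.lt_floor_add_one x
    rw [← hN] at this
    linarith
  -- the pieces
  have hS := hM x hx
  rw [sum_inv_absNorm_eq_normSum K hx0.le] at hS
  have hsplit : ∑' m : ℕ, rTerm K m 1 = ∑ m ∈ Icc 0 N, rTerm K m 1 + ∑' m : ℕ, rTerm K (m + (N + 1)) 1 := by
    rw [← range_succ_eq_Icc_zero, (summable_rTerm K le_rfl).sum_add_tsum_nat_add (N + 1)]
  have htail := abs_tsum_rTerm_shift_le K hN1
  rw [← hd] at htail
  -- the identity
  have hmain : ∑ P ∈ (finite_primeIdealsLE K x).toFinset, -Real.log (1 - (Ideal.absNorm P : ℝ)⁻¹) -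
      (Real.log (Real.log x) + Real.eulerMascheroniConstant + Real.log (dedekindZeta_residue K)) =
      (∑ m ∈ Icc 0 N, (normPrimeIdealCount K m : ℝ) / m - (Real.log (Real.log x) + M)) -
        ∑' m : ℕ, rTerm K (m + (N + 1)) 1 := by
    rw [sum_neg_log_eq_sum_wTerm K hx0.le, sum_wTerm_one_eq, ← hid, hsplit]
    ring
  rw [hmain]
  -- bounds
  have htail' : |∑' m : ℕ, rTerm K (m + (N + 1)) 1| ≤ 16 * d / Real.log x ^ 2 := by
    refine htail.trans ?_
    have hN0 : (0 : ℝ) < N := by linarith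
    -- `(log x)² ≤ 4x` (`log x ≤ 2√x`; cf. `Literature.NumberTheory.Transcendental.log_sq_le_four_mul`)
    have hlog4 : Real.log x ^ 2 ≤ 4 * x := by
      have h1 : Real.log x ≤ x ^ ((1 : ℝ) / 2) / ((1 : ℝ) / 2) := Real.log_le_rpow_div hx0.le (by norm_num)
      have hsq : (x ^ ((1 : ℝ) / 2)) ^ 2 = x := by
        rw [← Real.rpow_natCast, ← Real.rpow_mul hx0.le]; norm_num
      have h0 : 0 ≤ x ^ ((1 : ℝ) / 2) := by positivity
      have hl : 0 ≤ Real.log x := hlx.le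
      have h2 : Real.log x ≤ 2 * x ^ ((1 : ℝ) / 2) := by linarith
      nlinarith
    rw [div_le_div_iff₀ hN0 (by positivity)]
    nlinarith
  calc |∑ m ∈ Icc 0 N, (normPrimeIdealCount K m : ℝ) / m - (Real.log (Real.log x) + M) -
        ∑' m : ℕ, rTerm K (m + (N + 1)) 1|
      ≤ |∑ m ∈ Icc 0 N, (normPrimeIdealCount K m : ℝ) / m - (Real.log (Real.log x) + M)| +
        |∑' m : ℕ, rTerm K (m + (N + 1)) 1| := abs_sub _ _
    _ ≤ C / Real.log x ^ 2 + 16 * d / Real.log x ^ 2 := add_le_add hS htail'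
    _ = (C + 16 * d) / Real.log x ^ 2 := by ring

end Literature.NumberTheory.LFunctions.NumberField

end
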